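import Mathlib
import HarnessLib

/-!
# ABC 1:1:1 skeleton separation: distinct rope-carrying diagonals are ≥ π/√2 apart on the torus

HONEST FRAMING (cell `ns-blowup`, seat `ns-blowup-instab2`; human ruling D-0035): nothing here is a
claim about Navier–Stokes blow-up. WHAT THIS IS NOT: not dynamics; it is the torus geometry behind
`HOME/instab2/HEREDITY-P3.md` (F).

The stagnation skeleton of the ABC flow `U = (sin z + cos y, sin x + cos z, sin y + cos x)` on
`𝕋³ = (ℝ/2πℤ)³` consists of four closed straight lines (KILLSHEET XIII.4, selfsim HEREDITY §2 T2,
tower-A selftest T1): `L_i = {α_i + t·d_i}` with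
`α_0 = π(7/4,7/4,7/4)`, `d_0 = (1,1,1)`; `α_1 = π(3/4,1/4,5/4)`, `d_1 = (1,−1,−1)`;
`α_2 = π(5/4,3/4,1/4)`, `d_2 = (−1,1,−1)`; `α_3 = π(1/4,5/4,3/4)`, `d_3 = (−1,−1,1)` — each carrying one
α-point and one β-point (`β_i = α_i + π d_i`), i.e. the four class-II ropes of the P-TOWER-1′ object sit
on these lines. We prove, for every pair `i ≠ j`, every pair of parameters and every lattice shift
`2πn`, `n ∈ ℤ³`, that the squared Euclidean distance between a point of `L_i` and a (shifted) point of
`L_j` is at least `π²/2`; and that `π²/2` is attained (between `α_0` and `β_1`). Hence the torus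
distance between distinct rope axes is exactly `π/√2 ≈ 2.221/k` — about 21–27 rope radii at
`R = 300–500` — so the «nearly touching non-parallel cores» geometry that level-2 heredity needs
(HEREDITY-P3 (B)) is never realised by pinned ropes of this host (HEREDITY-P3 (F)).

The mechanism is a parity obstruction: for each pair, `c = (d_i × d_j)/2 ∈ {0, ±1}³` kills both
parameters and `c · (α_i − α_j) = ±π`, so `c · D ∈ π(2ℤ + 1)` for the difference vector `D`, whence
`|D|² ≥ (c·D)²/|c|² ≥ π²/2`. Mathlib only; no definitions.
-/

namespace Summit.NavierStokesRegularity.FluidComputer.ABCSkeletonSeparation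

/-- Parity lemma: if `a − b` is an odd multiple of `π` then `a² + b² ≥ π²/2`. -/
theorem sq_add_sq_ge_of_sub_odd (a b : ℝ) (k : ℤ) (h : a - b = Real.pi * (1 - 2 * (k : ℝ))) :
    Real.pi ^ 2 / 2 ≤ a ^ 2 + b ^ 2 := by
  have hk : (1 : ℝ) ≤ (1 - 2 * (k : ℝ)) ^ 2 := by
    rcases le_or_gt k 0 with hle | hgt
    · have : (k : ℝ) ≤ 0 := by exact_mod_cast hle
      nlinarith
    · have : (1 : ℝ) ≤ (k : ℝ) := by exact_mod_cast hgt
      nlinarith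
  have hpi : 0 ≤ Real.pi ^ 2 := sq_nonneg _
  have h1 : Real.pi ^ 2 ≤ (a - b) ^ 2 := by
    rw [h, mul_pow]
    nlinarith
  nlinarith [sq_nonneg (a + b)]

/-- Same with a sum: if `a + b` is an odd multiple of `π` then `a² + b² ≥ π²/2`. -/
theorem sq_add_sq_ge_of_add_odd (a b : ℝ) (k : ℤ) (h : a + b = Real.pi * (1 - 2 * (k : ℝ))) :
    Real.pi ^ 2 / 2 ≤ a ^ 2 + b ^ 2 := by
  have h' : a - (-b) = Real.pi * (1 - 2 * (k : ℝ)) := by rw [sub_neg_eq_add]; exact h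
  have := sq_add_sq_ge_of_sub_odd a (-b) k h'
  simpa using this

/-- Lines `L_0` (through `α_0 = π(7/4,7/4,7/4)`, direction `(1,1,1)`) and `L_1` (through
`α_1 = π(3/4,1/4,5/4)`, direction `(1,−1,−1)`): squared distance `≥ π²/2` for all parameters and all
lattice shifts. Obstruction `c = (0,1,−1)`. -/
theorem dist_sq_L0_L1 (u s : ℝ) (n₁ n₂ n₃ : ℤ) :
    Real.pi ^ 2 / 2 ≤
      (7 * Real.pi / 4 + u - (3 * Real.pi / 4 + s) - 2 * Real.pi * n₁) ^ 2 +
      (7 * Real.pi / 4 + u - (Real.pi / 4 - s) - 2 * Real.pi * n₂) ^ 2 +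
      (7 * Real.pi / 4 + u - (5 * Real.pi / 4 - s) - 2 * Real.pi * n₃) ^ 2 := by
  have h := sq_add_sq_ge_of_sub_odd
    (7 * Real.pi / 4 + u - (Real.pi / 4 - s) - 2 * Real.pi * n₂)
    (7 * Real.pi / 4 + u - (5 * Real.pi / 4 - s) - 2 * Real.pi * n₃) (n₂ - n₃)
    (by push_cast; ring)
  nlinarith [sq_nonneg (7 * Real.pi / 4 + u - (3 * Real.pi / 4 + s) - 2 * Real.pi * n₁)]

/-- Lines `L_0` and `L_2` (through `α_2 = π(5/4,3/4,1/4)`, direction `(−1,1,−1)`). Obstruction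
`c = (−1,0,1)`. -/
theorem dist_sq_L0_L2 (u s : ℝ) (n₁ n₂ n₃ : ℤ) :
    Real.pi ^ 2 / 2 ≤
      (7 * Real.pi / 4 + u - (5 * Real.pi / 4 - s) - 2 * Real.pi * n₁) ^ 2 +
      (7 * Real.pi / 4 + u - (3 * Real.pi / 4 + s) - 2 * Real.pi * n₂) ^ 2 +
      (7 * Real.pi / 4 + u - (Real.pi / 4 - s) - 2 * Real.pi * n₃) ^ 2 := by
  have h := sq_add_sq_ge_of_sub_odd
    (7 * Real.pi / 4 + u - (Real.pi / 4 - s) - 2 * Real.pi * n₃)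
    (7 * Real.pi / 4 + u - (5 * Real.pi / 4 - s) - 2 * Real.pi * n₁) (n₃ - n₁)
    (by push_cast; ring)
  nlinarith [sq_nonneg (7 * Real.pi / 4 + u - (3 * Real.pi / 4 + s) - 2 * Real.pi * n₂)]

/-- Lines `L_0` and `L_3` (through `α_3 = π(1/4,5/4,3/4)`, direction `(−1,−1,1)`). Obstruction
`c = (1,−1,0)`. -/
theorem dist_sq_L0_L3 (u s : ℝ) (n₁ n₂ n₃ : ℤ) :
    Real.pi ^ 2 / 2 ≤
      (7 * Real.pi / 4 + u - (Real.pi / 4 - s) - 2 * Real.pi * n₁) ^ 2 +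
      (7 * Real.pi / 4 + u - (5 * Real.pi / 4 - s) - 2 * Real.pi * n₂) ^ 2 +
      (7 * Real.pi / 4 + u - (3 * Real.pi / 4 + s) - 2 * Real.pi * n₃) ^ 2 := by
  have h := sq_add_sq_ge_of_sub_odd
    (7 * Real.pi / 4 + u - (Real.pi / 4 - s) - 2 * Real.pi * n₁)
    (7 * Real.pi / 4 + u - (5 * Real.pi / 4 - s) - 2 * Real.pi * n₂) (n₁ - n₂)
    (by push_cast; ring)
  nlinarith [sq_nonneg (7 * Real.pi / 4 + u - (3 * Real.pi / 4 + s) - 2 * Real.pi * n₃)]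

/-- Lines `L_1` (`α_1 = π(3/4,1/4,5/4)`, `d_1 = (1,−1,−1)`) and `L_2` (`α_2 = π(5/4,3/4,1/4)`,
`d_2 = (−1,1,−1)`). Obstruction `c = (1,1,0)` (a SUM of two coordinates). -/
theorem dist_sq_L1_L2 (u s : ℝ) (n₁ n₂ n₃ : ℤ) :
    Real.pi ^ 2 / 2 ≤
      (3 * Real.pi / 4 + u - (5 * Real.pi / 4 - s) - 2 * Real.pi * n₁) ^ 2 +
      (Real.pi / 4 - u - (3 * Real.pi / 4 + s) - 2 * Real.pi * n₂) ^ 2 +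
      (5 * Real.pi / 4 - u - (Real.pi / 4 - s) - 2 * Real.pi * n₃) ^ 2 := by
  have h := sq_add_sq_ge_of_add_odd
    (3 * Real.pi / 4 + u - (5 * Real.pi / 4 - s) - 2 * Real.pi * n₁)
    (Real.pi / 4 - u - (3 * Real.pi / 4 + s) - 2 * Real.pi * n₂) (n₁ + n₂ + 1)
    (by push_cast; ring)
  nlinarith [sq_nonneg (5 * Real.pi / 4 - u - (Real.pi / 4 - s) - 2 * Real.pi * n₃)]

/-- Lines `L_1` and `L_3` (`α_3 = π(1/4,5/4,3/4)`, `d_3 = (−1,−1,1)`). Obstruction `c = (1,0,1)`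
(sum of the first and third coordinates). -/
theorem dist_sq_L1_L3 (u s : ℝ) (n₁ n₂ n₃ : ℤ) :
    Real.pi ^ 2 / 2 ≤
      (3 * Real.pi / 4 + u - (Real.pi / 4 - s) - 2 * Real.pi * n₁) ^ 2 +
      (Real.pi / 4 - u - (5 * Real.pi / 4 - s) - 2 * Real.pi * n₂) ^ 2 +
      (5 * Real.pi / 4 - u - (3 * Real.pi / 4 + s) - 2 * Real.pi * n₃) ^ 2 := by
  have h := sq_add_sq_ge_of_add_odd
    (3 * Real.pi / 4 + u - (Real.pi / 4 - s) - 2 * Real.pi * n₁)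
    (5 * Real.pi / 4 - u - (3 * Real.pi / 4 + s) - 2 * Real.pi * n₃) (n₁ + n₃)
    (by push_cast; ring)
  nlinarith [sq_nonneg (Real.pi / 4 - u - (5 * Real.pi / 4 - s) - 2 * Real.pi * n₂)]

/-- Lines `L_2` (`α_2 = π(5/4,3/4,1/4)`, `d_2 = (−1,1,−1)`) and `L_3` (`α_3 = π(1/4,5/4,3/4)`,
`d_3 = (−1,−1,1)`). Obstruction `c = (0,1,1)`. -/
theorem dist_sq_L2_L3 (u s : ℝ) (n₁ n₂ n₃ : ℤ) :
    Real.pi ^ 2 / 2 ≤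
      (5 * Real.pi / 4 - u - (Real.pi / 4 - s) - 2 * Real.pi * n₁) ^ 2 +
      (3 * Real.pi / 4 + u - (5 * Real.pi / 4 - s) - 2 * Real.pi * n₂) ^ 2 +
      (Real.pi / 4 - u - (3 * Real.pi / 4 + s) - 2 * Real.pi * n₃) ^ 2 := by
  have h := sq_add_sq_ge_of_add_odd
    (3 * Real.pi / 4 + u - (5 * Real.pi / 4 - s) - 2 * Real.pi * n₂)
    (Real.pi / 4 - u - (3 * Real.pi / 4 + s) - 2 * Real.pi * n₃) (n₂ + n₃ + 1)
    (by push_cast; ring)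
  nlinarith [sq_nonneg (5 * Real.pi / 4 - u - (Real.pi / 4 - s) - 2 * Real.pi * n₁)]

/-- The bound is sharp: `α_0 = π(7/4,7/4,7/4)` and `β_1 = α_1 + π d_1 = π(7/4, −3/4, 1/4)` are at
squared distance exactly `π²/2` after the lattice shift `n = (0, 1, 1)` (`α_0 − β_1 − 2π(0,1,1) =
π(0, ½, −½)`): the torus distance between distinct skeleton lines is exactly `π/√2`. -/
theorem dist_sq_alpha0_beta1 :
    (7 * Real.pi / 4 - (7 * Real.pi / 4) - 2 * Real.pi * 0) ^ 2 +
      (7 * Real.pi / 4 - (-(3 * Real.pi / 4)) - 2 * Real.pi * 1) ^ 2 +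
      (7 * Real.pi / 4 - (Real.pi / 4) - 2 * Real.pi * 1) ^ 2 = Real.pi ^ 2 / 2 := by
  ring

/-- Numerical corollary used in the memo: `π²/2 > 4.9`, i.e. the separation exceeds `2.2136` (while a
rope radius is `≈ 0.1` at `R = 300`). -/
theorem pi_sq_half_gt : (4.9 : ℝ) < Real.pi ^ 2 / 2 := by
  have h := Real.pi_gt_d2
  nlinarith

/-! ## The numbers at the P-TOWER-1′ hosts (instab2 g3 append; HEREDITY-P3 (F) «20.8 / 26.9 rope radii», «θ ≲ (a/D)² ≈ 2·10⁻³»,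
«χ_halo ≤ e^{−(D/2a)²} < 10⁻⁴⁰»)

Rope radius of record `a(R) = 1.1 δ_B = 2.2 r_c`, `r_c = (ν/σ_α)^{1/2} = (1/(R√2))^{1/2}` (NORMALISATIONS-OF-RECORD §1);
minimum distance between distinct rope-carrying lines `D_min = π/√2` (`dist_sq_*` above, `pi_sq_half_gt`). -/

/-- At `R = 300`: `D_min = π/√2 > 20 · a(300)`, i.e. pinned ropes are more than 20 radii apart
(`π/√2 = 2.2214`, `a(300) = 2.2/√(300√2) = 0.1068`, ratio 20.8). -/
theorem dmin_gt_twenty_radii_300 :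
    20 * (2.2 * Real.sqrt (1 / (300 * Real.sqrt 2))) < Real.pi / Real.sqrt 2 := by
  have hs2 : 1.4142 < Real.sqrt 2 := by
    rw [Real.lt_sqrt (by norm_num)]; norm_num
  have hs2' : 0 < Real.sqrt 2 := by positivity
  have hpi : 3.1415 < Real.pi := Real.pi_gt_d4
  -- square both sides: (44 s)² = 1936/(300√2) < π²/2
  have hpos : 0 < 300 * Real.sqrt 2 := by positivity
  have hL : (20 * (2.2 * Real.sqrt (1 / (300 * Real.sqrt 2)))) ^ 2 = 1936 / (300 * Real.sqrt 2) := by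
    rw [mul_pow, mul_pow, Real.sq_sqrt (by positivity)]
    field_simp
    norm_num
  have hR : (Real.pi / Real.sqrt 2) ^ 2 = Real.pi ^ 2 / 2 := by
    rw [div_pow, Real.sq_sqrt (by norm_num)]
  have hlt : 1936 / (300 * Real.sqrt 2) < Real.pi ^ 2 / 2 := by
    rw [div_lt_div_iff₀ hpos (by norm_num : (0 : ℝ) < 2)]
    have hp2 : 9.869 < Real.pi ^ 2 := by nlinarith [hpi, Real.pi_pos]
    nlinarith [hs2, hp2]
  have h1 : 0 ≤ 20 * (2.2 * Real.sqrt (1 / (300 * Real.sqrt 2))) := by positivity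
  have h2 : 0 ≤ Real.pi / Real.sqrt 2 := by positivity
  nlinarith [hL, hR, hlt, h1, h2, sq_nonneg (20 * (2.2 * Real.sqrt (1 / (300 * Real.sqrt 2))) - Real.pi / Real.sqrt 2)]

/-- At `R = 500`: `D_min = π/√2 > 26 · a(500)` (`a(500) = 0.0827`, ratio 26.9). -/
theorem dmin_gt_twentysix_radii_500 :
    26 * (2.2 * Real.sqrt (1 / (500 * Real.sqrt 2))) < Real.pi / Real.sqrt 2 := by
  have hs2 : 1.4142 < Real.sqrt 2 := by
    rw [Real.lt_sqrt (by norm_num)]; norm_num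
  have hpi : 3.1415 < Real.pi := Real.pi_gt_d4
  have hpos : 0 < 500 * Real.sqrt 2 := by positivity
  have hL : (26 * (2.2 * Real.sqrt (1 / (500 * Real.sqrt 2)))) ^ 2 = 3271.84 / (500 * Real.sqrt 2) := by
    rw [mul_pow, mul_pow, Real.sq_sqrt (by positivity)]
    field_simp
    norm_num
  have hR : (Real.pi / Real.sqrt 2) ^ 2 = Real.pi ^ 2 / 2 := by
    rw [div_pow, Real.sq_sqrt (by norm_num)]
  have hlt : 3271.84 / (500 * Real.sqrt 2) < Real.pi ^ 2 / 2 := by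
    rw [div_lt_div_iff₀ hpos (by norm_num : (0 : ℝ) < 2)]
    have hp2 : 9.869 < Real.pi ^ 2 := by nlinarith [hpi, Real.pi_pos]
    nlinarith [hs2, hp2]
  have h1 : 0 ≤ 26 * (2.2 * Real.sqrt (1 / (500 * Real.sqrt 2))) := by positivity
  have h2 : 0 ≤ Real.pi / Real.sqrt 2 := by positivity
  nlinarith [hL, hR, hlt, h1, h2, sq_nonneg (26 * (2.2 * Real.sqrt (1 / (500 * Real.sqrt 2))) - Real.pi / Real.sqrt 2)]

/-- MUTUAL STRAIN CONSTANT while pinned: if `D ≥ 20 a > 0` then `(a/D)² ≤ 1/400 = 2.5·10⁻³`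
(HEREDITY-P3 (B): far-field strain of a Gaussian core at distance `D` is `≤ (a/D)²·ω₀/2`). -/
theorem mutual_strain_const_le {a D : ℝ} (ha : 0 < a) (h : 20 * a ≤ D) : (a / D) ^ 2 ≤ 1 / 400 := by
  have hD : 0 < D := by linarith
  rw [div_pow, div_le_div_iff₀ (by positivity) (by norm_num)]
  nlinarith [h, ha]

/-- HALO SUPPLY CONSTANT while pinned: if `D ≥ 20 a > 0` then the Gaussian halo factor at the midpoint
obeys `e^{−(D/(2a))²} ≤ e^{−100}` … -/
theorem halo_factor_le {a D : ℝ} (ha : 0 < a) (h : 20 * a ≤ D) :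
    Real.exp (-(D / (2 * a)) ^ 2) ≤ Real.exp (-100) := by
  rw [Real.exp_le_exp]
  have hq : 10 ≤ D / (2 * a) := by
    rw [le_div_iff₀ (by positivity)]; linarith
  nlinarith [hq]

/-- … and `e^{−100} < 10⁻⁴³` (`e > 2.7`, `2.7^{100} = 27^{100}/10^{100} > 10^{43}`): the χ_halo of a pinned
configuration is below `10⁻⁴³` at `R = 300` — «level-2 sites BETWEEN pinned ropes do not exist». -/
theorem exp_neg_hundred_lt : Real.exp (-100) < (10 : ℝ)⁻¹ ^ 43 := by
  have he : (2.7 : ℝ) < Real.exp 1 := lt_trans (by norm_num) Real.exp_one_gt_d9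
  have h100 : Real.exp 100 = Real.exp 1 ^ 100 := by
    rw [← Real.exp_nat_mul]; norm_num
  have hpow : (2.7 : ℝ) ^ 100 < Real.exp 1 ^ 100 := pow_lt_pow_left₀ he (by norm_num) (by norm_num)
  have hbig : (10 : ℝ) ^ 43 < (2.7 : ℝ) ^ 100 := by norm_num
  have hE : (10 : ℝ) ^ 43 < Real.exp 100 := by rw [h100]; linarith
  have hexp : Real.exp (-100) = (Real.exp 100)⁻¹ := by rw [Real.exp_neg]
  rw [hexp, inv_pow]
  exact inv_strictAnti₀ (by positivity) hE

end Summit.NavierStokesRegularity.FluidComputer.ABCSkeletonSeparation
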